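import Summits.ValiantsHypothesis.ValiantsHypothesis.Theorems.SymPencilSingSixClassificationPerpPlanes
import Summits.ValiantsHypothesis.ValiantsHypothesis.Theorems.SymPencilSingSixClassificationTransport

/-!
# Route `SymPencil` — leaf R1N of the `(11, 5, 4)` cascade, kernel-plane tools (`--supports`
# stmt-ValiantsHypothesis-5674 `SdcSuperquadratic`; memo `SING-FIVE-CLASSIFICATION.md` §6.2/§6.4, for the residual
# `stub_threeRowsFourCols` of `Cruxes/SdcSuperquadratic/Lines/sing_five_classification.lean`; rung currency only)

Setting of leaf R1N: `W ⊆ K^{4×4}`, one zero row `i`, live rows `r, s, t`; `A_r` = row `r` of `W` (`W.map (rowL r)`),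
`K_r = W ∩ {row r = 0}` (the kernel plane when `dim A_r = 3`).

* `vanish_of_mul_vanish` — a product of two additive functions vanishing on a subspace has a vanishing factor;
* `polar₂` — the SECOND polarisation reading of `Sing3` (memo (6.0), `s¹`): for `x, k ∈ W` with row `r` of `k`
  zero, `T3 (row x r) (row k s) (row x t) + T3 (row x r) (row x s) (row k t) = 0` (companion of ✓ `polar`);
* `exists_mem_coordPlane`, `permOrth_of_T3_hyperplane` — `T3 u v w = 0` for `u` in a `3`-dimensional subspace of
  `K⁴` already forces `v ⊥ w`; `kernel_permOrth` — if `dim A_r = 3`, the rows `s, t` of every element of `K_r` are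
  perm-orthogonal (so ✓ `perpPlanes` applies to `K_r`); `finrank_kernel_add`, `mem_kernel_iff`;
* `T3_border`, `eq_zero_of_T3_border` — the bordered form of `T3 u v b` when `u, b ⊥ e_m`.

Consumers: `SymPencilPerFourOneRowKernelPlanePure` (PURE / GRAPH kernel planes are impossible) and the §6.5/§6.6
files.  Honest framing: [folklore] linear algebra for ONE leaf of ONE of four open size-27 cells; leaf R1N and the cell
file remain OPEN; `27 ≤ sdc(per₄) ≤ 29` unchanged; the crux `SdcSuperquadratic` and `VP ≠ VNP` untouched; no summit
statement is proved here.  No definitions, no named facts.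
-/

noncomputable section

set_option linter.dupNamespace false

namespace Summit.ValiantsHypothesis.ValiantsHypothesis.Theorems.SymPencilPerFourOneRowKernelPlane

open Matrix Module MvPolynomial
open Literature.Computability.AlgebraicComplexity
open Summit.ValiantsHypothesis.ValiantsHypothesis.Theorems.SymPencilSingSixClassification

variable {K : Type*} [Field K]

/-! ## 1. Small tools -/

/-- A product of two additive functions vanishing on a subspace has a factor vanishing there. [folklore] -/
theorem vanish_of_mul_vanish {M : Type*} [AddCommGroup M] [Module K M] (P : Submodule K M)
    (φ ψ : M → K) (hφ : ∀ a b, φ (a + b) = φ a + φ b) (hψ : ∀ a b, ψ (a + b) = ψ a + ψ b)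
    (h : ∀ y ∈ P, φ y * ψ y = 0) {y₀ : M} (hy₀ : y₀ ∈ P) (h0 : φ y₀ ≠ 0) :
    ∀ y ∈ P, ψ y = 0 := by
  intro y hy
  by_contra hne
  have hφy : φ y = 0 := by
    rcases mul_eq_zero.1 (h y hy) with h1 | h1
    · exact h1
    · exact absurd h1 hne
  have hψ0 : ψ y₀ = 0 := by
    rcases mul_eq_zero.1 (h y₀ hy₀) with h1 | h1
    · exact absurd h1 h0
    · exact h1
  have hsum := h (y₀ + y) (P.add_mem hy₀ hy)
  rw [hφ, hψ, hφy, hψ0, add_zero, zero_add] at hsum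
  rcases mul_eq_zero.1 hsum with h1 | h1
  · exact h0 h1
  · exact hne h1

/-- `T3` with zero middle argument vanishes. [folklore] -/
theorem T3_zero₂ (u w : Fin 4 → K) (l : Fin 4) : T3 u 0 w l = 0 := by
  simp [T3]

/-- **Second polarisation reading** (memo (6.0), `s¹`-coefficient): for `x, k ∈ W` with row `r` of `k`
zero, `T3 (row x r) (row k s) (row x t) + T3 (row x r) (row x s) (row k t) = 0`. [folklore] -/
theorem polar₂ [CharZero K] {W : Submodule K (Fin 4 × Fin 4 → K)} (hS : Sing3 W)
    {r s t : Fin 4} (hrs : r ≠ s) (hrt : r ≠ t) (hst : s ≠ t)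
    {x : Fin 4 × Fin 4 → K} (hx : x ∈ W) {k : Fin 4 × Fin 4 → K} (hk : k ∈ W)
    (hkr : row k r = 0) (l : Fin 4) :
    T3 (row x r) (row k s) (row x t) l + T3 (row x r) (row x s) (row k t) l = 0 := by
  have h1 := T3_eq_zero_of_sing3 hS (W.add_mem hx hk) r s t hrs hrt hst l
  have h2 := T3_eq_zero_of_sing3 hS (W.sub_mem hx hk) r s t hrs hrt hst l
  rw [row_add, row_add, row_add, hkr, add_zero] at h1
  rw [row_sub, row_sub, row_sub, hkr, sub_zero] at h2
  have e1 : T3 (row x r) (row x s + row k s) (row x t + row k t) l =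
      T3 (row x r) (row x s) (row x t) l + T3 (row x r) (row x s) (row k t) l +
        T3 (row x r) (row k s) (row x t) l + T3 (row x r) (row k s) (row k t) l := by
    simp only [T3, Pi.add_apply]; ring
  have e2 : T3 (row x r) (row x s - row k s) (row x t - row k t) l =
      T3 (row x r) (row x s) (row x t) l - T3 (row x r) (row x s) (row k t) l -
        T3 (row x r) (row k s) (row x t) l + T3 (row x r) (row k s) (row k t) l := by
    simp only [T3, Pi.sub_apply]; ring
  have h3 : (2 : K) * (T3 (row x r) (row k s) (row x t) l + T3 (row x r) (row x s) (row k t) l) = 0 := by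
    linear_combination h1 - h2 - e1 + e2
  rcases mul_eq_zero.mp h3 with h | h
  · exact absurd h two_ne_zero
  · exact h

/-- A `3`-dimensional subspace of `K⁴` meets every coordinate plane `span (e_a, e_b)`. [folklore] -/
theorem exists_mem_coordPlane (A : Submodule K (Fin 4 → K)) (hA : finrank K A = 3) (a b : Fin 4)
    (hab : a ≠ b) : ∃ α β : K, (α ≠ 0 ∨ β ≠ 0) ∧
      (α • (Pi.single a 1 : Fin 4 → K) + β • Pi.single b 1) ∈ A := by
  classical
  let S : Submodule K (Fin 4 → K) := Submodule.span K (Set.range ![(Pi.single a 1 : Fin 4 → K), Pi.single b 1])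
  have hli : LinearIndependent K ![(Pi.single a 1 : Fin 4 → K), Pi.single b 1] := by
    refine LinearIndependent.pair_iff.2 fun p q hpq => ?_
    have ha := congr_fun hpq a
    have hb := congr_fun hpq b
    simp [hab, hab.symm] at ha hb
    exact ⟨ha, hb⟩
  have hS2 : finrank K S = 2 := by
    have := finrank_span_eq_card hli
    simpa using this
  have hsum := Submodule.finrank_sup_add_finrank_inf_eq A S
  have hle : finrank K ↥(A ⊔ S) ≤ 4 := by
    have := Submodule.finrank_le (A ⊔ S)
    simpa using this
  have hinf : A ⊓ S ≠ ⊥ := by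
    intro h
    rw [h, finrank_bot, hA, hS2] at hsum
    omega
  obtain ⟨u, hu, hu0⟩ := Submodule.exists_mem_ne_zero_of_ne_bot hinf
  obtain ⟨huA, huS⟩ := Submodule.mem_inf.1 hu
  obtain ⟨c, hc⟩ := (Submodule.mem_span_range_iff_exists_fun K).1 huS
  refine ⟨c 0, c 1, ?_, ?_⟩
  · by_contra hzero
    push Not at hzero
    apply hu0
    rw [← hc, Fin.sum_univ_two, hzero.1, hzero.2]
    simp
  · have : (∑ i, c i • ![(Pi.single a 1 : Fin 4 → K), Pi.single b 1] i) =
        c 0 • (Pi.single a 1 : Fin 4 → K) + c 1 • Pi.single b 1 := by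
      rw [Fin.sum_univ_two]; rfl
    rw [← this, hc]; exact huA

/-- `T3 u v w = 0` for all `u` in a `3`-dimensional subspace of `K⁴` already forces `v ⊥ w`.
[folklore] -/
theorem permOrth_of_T3_hyperplane (A : Submodule K (Fin 4 → K)) (hA : finrank K A = 3)
    {v w : Fin 4 → K} (h : ∀ u ∈ A, ∀ l, T3 u v w l = 0) : PermOrth v w := by
  intro p q hpq
  -- the coordinate plane complementary to `{p, q}`
  fin_cases p <;> fin_cases q
  all_goals (first | exact absurd rfl hpq | skip)
  · -- (p, q) = (0, 1); coordinate plane (2, 3)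
    show pairPerm v w 0 1 = 0
    obtain ⟨α, β, hne, hu⟩ := exists_mem_coordPlane A hA 2 3 (by decide)
    have ha := h _ hu 2
    have hb := h _ hu 3
    simp [T3, Fin.succAbove] at ha hb
    unfold pairPerm
    rcases hne with hα | hβ
    · linear_combination hb.resolve_left hα
    · linear_combination ha.resolve_left hβ
  · -- (p, q) = (0, 2); coordinate plane (1, 3)
    show pairPerm v w 0 2 = 0
    obtain ⟨α, β, hne, hu⟩ := exists_mem_coordPlane A hA 1 3 (by decide)
    have ha := h _ hu 1
    have hb := h _ hu 3
    simp [T3, Fin.succAbove] at ha hb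
    unfold pairPerm
    rcases hne with hα | hβ
    · linear_combination hb.resolve_left hα
    · linear_combination ha.resolve_left hβ
  · -- (p, q) = (0, 3); coordinate plane (1, 2)
    show pairPerm v w 0 3 = 0
    obtain ⟨α, β, hne, hu⟩ := exists_mem_coordPlane A hA 1 2 (by decide)
    have ha := h _ hu 1
    have hb := h _ hu 2
    simp [T3, Fin.succAbove] at ha hb
    unfold pairPerm
    rcases hne with hα | hβ
    · linear_combination hb.resolve_left hα
    · linear_combination ha.resolve_left hβ
  · -- (p, q) = (1, 0); coordinate plane (2, 3)
    show pairPerm v w 1 0 = 0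
    obtain ⟨α, β, hne, hu⟩ := exists_mem_coordPlane A hA 2 3 (by decide)
    have ha := h _ hu 2
    have hb := h _ hu 3
    simp [T3, Fin.succAbove] at ha hb
    unfold pairPerm
    rcases hne with hα | hβ
    · linear_combination hb.resolve_left hα
    · linear_combination ha.resolve_left hβ
  · -- (p, q) = (1, 2); coordinate plane (0, 3)
    show pairPerm v w 1 2 = 0
    obtain ⟨α, β, hne, hu⟩ := exists_mem_coordPlane A hA 0 3 (by decide)
    have ha := h _ hu 0
    have hb := h _ hu 3
    simp [T3, Fin.succAbove] at ha hb
    unfold pairPerm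
    rcases hne with hα | hβ
    · linear_combination hb.resolve_left hα
    · linear_combination ha.resolve_left hβ
  · -- (p, q) = (1, 3); coordinate plane (0, 2)
    show pairPerm v w 1 3 = 0
    obtain ⟨α, β, hne, hu⟩ := exists_mem_coordPlane A hA 0 2 (by decide)
    have ha := h _ hu 0
    have hb := h _ hu 2
    simp [T3, Fin.succAbove] at ha hb
    unfold pairPerm
    rcases hne with hα | hβ
    · linear_combination hb.resolve_left hα
    · linear_combination ha.resolve_left hβ
  · -- (p, q) = (2, 0); coordinate plane (1, 3)
    show pairPerm v w 2 0 = 0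
    obtain ⟨α, β, hne, hu⟩ := exists_mem_coordPlane A hA 1 3 (by decide)
    have ha := h _ hu 1
    have hb := h _ hu 3
    simp [T3, Fin.succAbove] at ha hb
    unfold pairPerm
    rcases hne with hα | hβ
    · linear_combination hb.resolve_left hα
    · linear_combination ha.resolve_left hβ
  · -- (p, q) = (2, 1); coordinate plane (0, 3)
    show pairPerm v w 2 1 = 0
    obtain ⟨α, β, hne, hu⟩ := exists_mem_coordPlane A hA 0 3 (by decide)
    have ha := h _ hu 0
    have hb := h _ hu 3
    simp [T3, Fin.succAbove] at ha hb
    unfold pairPerm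
    rcases hne with hα | hβ
    · linear_combination hb.resolve_left hα
    · linear_combination ha.resolve_left hβ
  · -- (p, q) = (2, 3); coordinate plane (0, 1)
    show pairPerm v w 2 3 = 0
    obtain ⟨α, β, hne, hu⟩ := exists_mem_coordPlane A hA 0 1 (by decide)
    have ha := h _ hu 0
    have hb := h _ hu 1
    simp [T3, Fin.succAbove] at ha hb
    unfold pairPerm
    rcases hne with hα | hβ
    · linear_combination hb.resolve_left hα
    · linear_combination ha.resolve_left hβ
  · -- (p, q) = (3, 0); coordinate plane (1, 2)
    show pairPerm v w 3 0 = 0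
    obtain ⟨α, β, hne, hu⟩ := exists_mem_coordPlane A hA 1 2 (by decide)
    have ha := h _ hu 1
    have hb := h _ hu 2
    simp [T3, Fin.succAbove] at ha hb
    unfold pairPerm
    rcases hne with hα | hβ
    · linear_combination hb.resolve_left hα
    · linear_combination ha.resolve_left hβ
  · -- (p, q) = (3, 1); coordinate plane (0, 2)
    show pairPerm v w 3 1 = 0
    obtain ⟨α, β, hne, hu⟩ := exists_mem_coordPlane A hA 0 2 (by decide)
    have ha := h _ hu 0
    have hb := h _ hu 2
    simp [T3, Fin.succAbove] at ha hb
    unfold pairPerm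
    rcases hne with hα | hβ
    · linear_combination hb.resolve_left hα
    · linear_combination ha.resolve_left hβ
  · -- (p, q) = (3, 2); coordinate plane (0, 1)
    show pairPerm v w 3 2 = 0
    obtain ⟨α, β, hne, hu⟩ := exists_mem_coordPlane A hA 0 1 (by decide)
    have ha := h _ hu 0
    have hb := h _ hu 1
    simp [T3, Fin.succAbove] at ha hb
    unfold pairPerm
    rcases hne with hα | hβ
    · linear_combination hb.resolve_left hα
    · linear_combination ha.resolve_left hβ

/-! ## 2. The kernel plane `K_r = W ∩ {row r = 0}` -/

/-- **Rows `s, t` of the kernel plane are perm-orthogonal** when row `r` of `W` has rank `3`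
(`Sing3` polarisation `polar`: `T3 (row x r) (row k s) (row k t) = 0` for all `x ∈ W`, and `row x r` fills a
hyperplane of `K⁴`). [folklore] -/
theorem kernel_permOrth [CharZero K] {W : Submodule K (Fin 4 × Fin 4 → K)} (hS : Sing3 W)
    {r s t : Fin 4} (hrs : r ≠ s) (hrt : r ≠ t) (hst : s ≠ t) (hnr : finrank K (W.map (rowL r)) = 3)
    {k : Fin 4 × Fin 4 → K} (hk : k ∈ W) (hkr : row k r = 0) : PermOrth (row k s) (row k t) := by
  refine permOrth_of_T3_hyperplane (W.map (rowL r)) hnr fun u hu l => ?_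
  obtain ⟨x, hx, rfl⟩ := Submodule.mem_map.1 hu
  exact polar hS hrs hrt hst hx hk hkr l

/-- Rank–nullity for a row: `dim (W ∩ {row r = 0}) + dim (row r of W) = dim W`. [folklore] -/
theorem finrank_kernel_add (W : Submodule K (Fin 4 × Fin 4 → K)) (r : Fin 4) :
    finrank K ↥(W ⊓ LinearMap.ker (rowL r)) + finrank K (W.map (rowL r)) = finrank K W := by
  have h := LinearMap.finrank_range_add_finrank_ker ((rowL r).comp W.subtype)
  rw [LinearMap.range_comp, Submodule.range_subtype, LinearMap.ker_comp] at h
  rw [← Submodule.finrank_map_subtype_eq W (Submodule.comap W.subtype (LinearMap.ker (rowL r))),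
    Submodule.map_comap_subtype] at h
  omega

/-- Membership in the kernel plane. [folklore] -/
theorem mem_kernel_iff {W : Submodule K (Fin 4 × Fin 4 → K)} {r : Fin 4} {k : Fin 4 × Fin 4 → K} :
    k ∈ W ⊓ LinearMap.ker (rowL r) ↔ k ∈ W ∧ row k r = 0 := by
  rw [Submodule.mem_inf, LinearMap.mem_ker]; rfl

/-! ## 3. Bordered `T3`: two arguments in the hyperplane `e_m^⊥` -/

/-- If `u_m = b_m = 0` then, for `l ≠ m`, `T3 u v b l = v_m · T3 u e_m b l` (only the `m`-th coordinate of the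
middle argument survives). [folklore] -/
theorem T3_border (m l : Fin 4) (hlm : l ≠ m) (u v b : Fin 4 → K) (hu : u m = 0) (hb : b m = 0) :
    T3 u v b l = v m * T3 u (Pi.single m 1) b l := by
  revert hu hb
  fin_cases m <;> fin_cases l
  all_goals (first | exact absurd rfl hlm | skip)
  all_goals
    intro hu hb
    simp at hu hb
    simp [T3, Fin.succAbove, hu, hb]
    try ring

/-- If `b_m = 0` and `T3 z e_m b l = 0` for all `z ⊥ e_m` and all `l ≠ m`, then `b = 0`. [folklore] -/
theorem eq_zero_of_T3_border (m : Fin 4) (b : Fin 4 → K) (hb : b m = 0)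
    (h : ∀ z : Fin 4 → K, z m = 0 → ∀ l, l ≠ m → T3 z (Pi.single m 1) b l = 0) : b = 0 := by
  funext c
  fin_cases m <;> fin_cases c
  · exact hb
  · simpa [T3, Fin.succAbove, Pi.single_apply] using h (Pi.single 2 1) (by simp) 3 (by decide)
  · simpa [T3, Fin.succAbove, Pi.single_apply] using h (Pi.single 1 1) (by simp) 3 (by decide)
  · simpa [T3, Fin.succAbove, Pi.single_apply] using h (Pi.single 1 1) (by simp) 2 (by decide)
  · simpa [T3, Fin.succAbove, Pi.single_apply] using h (Pi.single 2 1) (by simp) 3 (by decide)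
  · exact hb
  · simpa [T3, Fin.succAbove, Pi.single_apply] using h (Pi.single 0 1) (by simp) 3 (by decide)
  · simpa [T3, Fin.succAbove, Pi.single_apply] using h (Pi.single 0 1) (by simp) 2 (by decide)
  · simpa [T3, Fin.succAbove, Pi.single_apply] using h (Pi.single 1 1) (by simp) 3 (by decide)
  · simpa [T3, Fin.succAbove, Pi.single_apply] using h (Pi.single 0 1) (by simp) 3 (by decide)
  · exact hb
  · simpa [T3, Fin.succAbove, Pi.single_apply] using h (Pi.single 0 1) (by simp) 1 (by decide)
  · simpa [T3, Fin.succAbove, Pi.single_apply] using h (Pi.single 1 1) (by simp) 2 (by decide)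
  · simpa [T3, Fin.succAbove, Pi.single_apply] using h (Pi.single 0 1) (by simp) 2 (by decide)
  · simpa [T3, Fin.succAbove, Pi.single_apply] using h (Pi.single 0 1) (by simp) 1 (by decide)
  · exact hb

end Summit.ValiantsHypothesis.ValiantsHypothesis.Theorems.SymPencilPerFourOneRowKernelPlane

end
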